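import Summits.FinalStateConjecture.FinalStateConjecture.Theorems.ZeroEnergyKerrOrBombStationaryLimitReductionKerrIsometryRigidityWave3Facts
import Summits.FinalStateConjecture.FinalStateConjecture.Theorems.ZeroEnergyKerrOrBombStationaryLimitReductionKerrIsometryRigidityWave3EndMatchingCore
import Summits.FinalStateConjecture.FinalStateConjecture.Theorems.ZeroEnergyKerrOrBombStationaryLimitReductionTimeEquivariantMaps
import Literature.Geometry.Lorentzian.KerrWaveEnergy
import HarnessLib

/-!
# Route ZeroEnergyKerrOrBomb · crux `FinalStateFromKerrOrBomb` (stmt-FinalStateConjecture-17839), line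
# `SketchIdeator1` — stub `stub_kerrAsymptoticRigidity` (F4 of stub 1R), the bounded shells: F4 follows
# from its far-field version

Helper file (`--supports stmt-FinalStateConjecture-17839`; registered helper `kerrAsymptoticRigidity_of_far`)
of the lead's wave-2 stub-worker for `stub_kerrAsymptoticRigidity : SigM.stub_kerrAsymptoticRigidity`
(`:= KerrAsymptoticRigidity`, obligation F4 of stub 1R, `…KerrIsometryRigidityWave3Facts`). It discharges
the BOUNDED SHELLS of F4: the conclusion of `KerrAsymptoticRigidity` (bounded tilt `|(Θ u)⁰ − c u⁰|`,
bounded radial distortion `|r_A(Θ u) − r(u)|`, bounded `DⁿΘ`, `1 ≤ n ≤ 3`, on `{r ≥ r₊ + 1}`) follows from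
the same bounds on a far region `{r ≥ R}` (hypotheses of F4 repeated VERBATIM, plus the far-field bounds):

* §1 the five quantities are invariant under the Kerr–Schild time translation `u ↦ u + s e₀`, by
  `T`-equivariance `Θ (u + s e₀) = Θ u + (c s) e₀` on the (time-invariant, open) exterior: the tilt and the
  spatial part of `Θ` do not change, the adapted radius `A.radius` and the Kerr–Schild radius are time
  independent (`AdaptedChart.radius_ofTimeSpace`, `Kerr.radius_add_time_smul_basisVector`), and
  `DⁿΘ (u + s e₀) = DⁿΘ (u)` for `n ≥ 1` (`iteratedFDeriv_comp_add_right`, locality of `iteratedFDeriv`,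
  `fderiv_add_const`);
* §2 on the compact slice-shell `K = {u⁰ = 0, r₊ + 1 ≤ r(u) ≤ R}` of the exterior the continuous functions
  `Θ⁰ − c u⁰`, `‖(Θ u)_{space}‖ − r(u)` and `DⁿΘ` (`ContDiffOn.continuousOn_iteratedFDerivWithin`) are
  bounded (`IsCompact.exists_bound_of_continuousOn`), and `|A.radius − ‖·_{space}‖| ≤ C_A`
  (`AdaptedChart.exists_abs_radius_sub_spatialNorm_le`); every point of the shell `{r₊ + 1 ≤ r ≤ R}` is a
  time translate of a point of `K`.

Elementary; no named fact, nothing restated. References: P. T. Chruściel, J. L. Costa, arXiv:0806.0016,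
§2.1; S. Alexakis, A. D. Ionescu, S. Klainerman, arXiv:0904.0982, §1.1 (`T = ∂₀`, `r` time independent).
-/

set_option linter.dupNamespace false

noncomputable section

open scoped Manifold ContDiff Topology
open Set Filter Function

namespace Summit.FinalStateConjecture.FinalStateConjecture.Theorems.SymplecticDualOfTheBomb

open Literature.Geometry.Lorentzian
open Summit.FinalStateConjecture.FinalStateConjecture.Theorems.OneLockedExplosion

/-! ## §1 Time-translation invariance of the controlled quantities -/

section Invariance

variable {S : Set E4} {Θ : E4 → E4} {c : ℝ}

/-- **`DⁿΘ` is invariant under the time translation** for a `T`-equivariant `Θ` on an open time-invariant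
set and `n ≥ 1`: `DⁿΘ (x + s e₀) = Dⁿ(Θ (· + s e₀))(x) = Dⁿ(Θ + (c s) e₀)(x) = DⁿΘ (x)`. [folklore] -/
private theorem iteratedFDeriv_add_smul_eq (hSo : IsOpen S)
    (hΘT : ∀ x ∈ S, ∀ s : ℝ, Θ (x + s • E4.basisVector 0) = Θ x + (c * s) • E4.basisVector 0)
    {x : E4} (hx : x ∈ S) (s : ℝ) {n : ℕ} (hn : 1 ≤ n) :
    iteratedFDeriv ℝ n Θ (x + s • E4.basisVector 0) = iteratedFDeriv ℝ n Θ x := by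
  rw [← iteratedFDeriv_comp_add_right n (s • E4.basisVector 0) x]
  have h : (fun z ↦ Θ (z + s • E4.basisVector 0)) =ᶠ[𝓝 x] fun z ↦ Θ z + (c * s) • E4.basisVector 0 :=
    Filter.eventuallyEq_of_mem (hSo.mem_nhds hx) fun z hz ↦ hΘT z hz s
  rw [(h.iteratedFDeriv ℝ n).eq_of_nhds]
  obtain ⟨m, rfl⟩ : ∃ m, n = m + 1 := ⟨n - 1, by omega⟩
  rw [iteratedFDeriv_succ_eq_comp_right, iteratedFDeriv_succ_eq_comp_right]
  simp only [Function.comp_apply, fderiv_add_const]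

/-- `x + s e₀ = (x⁰ + s, x_{space})`. [folklore] -/
private theorem add_smul_eq_ofTimeSpace (x : E4) (s : ℝ) :
    x + s • E4.basisVector 0 = E4.ofTimeSpace (E4.time x + s) (E4.spatial x) := by
  conv_lhs => rw [← E4.ofTimeSpace_time_spatial x]
  exact E4.ofTimeSpace_add_smul _ _ _

/-- The adapted radius is invariant under chart-time translation (`AdaptedChart.radius_ofTimeSpace`).
[folklore] -/
private theorem adaptedChart_radius_add_smul {𝓑 : StationaryAFBlackHole.{0}} (A : 𝓑.AdaptedChart)
    (x : E4) (s : ℝ) : A.radius (x + s • E4.basisVector 0) = A.radius x := by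
  rw [add_smul_eq_ofTimeSpace, A.radius_ofTimeSpace]
  conv_rhs => rw [← E4.ofTimeSpace_time_spatial x, A.radius_ofTimeSpace]

/-- The spatial radius is invariant under time translation. [folklore] -/
private theorem spatialNorm_add_smul (x : E4) (s : ℝ) :
    E4.spatialNorm (x + s • E4.basisVector 0) = E4.spatialNorm x := by
  simp only [E4.spatialNorm, Kerr.spatial_add_smul_basisVector_zero]

end Invariance

/-! ## §2 The bounded shells: F4 from its far-field version -/

/-- **Registered helper `kerrAsymptoticRigidity_of_far`** (the bounded shells of F4 = `KerrAsymptoticRigidity`, whose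
binder list is repeated verbatim): if, under the hypotheses of F4, the tilt `|(Θ u)⁰ − c u⁰|`, the radial distortion
`|A.radius (Θ u) − r(u)|` and the derivatives `‖DⁿΘ u‖`, `1 ≤ n ≤ 3`, are bounded on SOME far region `{r ≥ R}` of
the Kerr exterior, then they are bounded on `{r ≥ r₊ + 1}`, i.e. the conclusion of F4 holds. On the shell
`{r₊ + 1 ≤ r ≤ R}` every point is a Kerr–Schild time translate `u' + u⁰ e₀` of a point `u'` of the COMPACT slice-shell
`K = {u⁰ = 0, r₊ + 1 ≤ r ≤ R} ⊆ {r > r₊}`, the five quantities are time-translation invariant (`T`-equivariance of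
`Θ`; `A.radius`, `r` time independent; `DⁿΘ (u + s e₀) = DⁿΘ u`), and on `K` they are bounded by continuity
(`Θ`, `DⁿΘ` continuous on the open exterior, `|A.radius − ‖·_{space}‖| ≤ C_A`). Chruściel–Costa arXiv:0806.0016,
§2.1; Alexakis–Ionescu–Klainerman arXiv:0904.0982, §1.1. [folklore] -/
theorem kerrAsymptoticRigidity_of_far : ∀ (𝓑 : StationaryAFBlackHole.{0}) (A : 𝓑.AdaptedChart) (M a c : ℝ) (Θ : E4 → E4), ChartIsAsymptoticallyCartesian A → ChartIsAsymptoticallySchwarzschildean' A → Kerr.IsSubextremal M a → 0 < c → ContDiffOn ℝ ∞ Θ (Kerr.exterior M a : Set E4) → Set.InjOn Θ (Kerr.exterior M a : Set E4) → Set.MapsTo Θ (Kerr.exterior M a : Set E4) (A.domain : Set E4) → (∀ x ∈ (Kerr.exterior M a : Set E4), ∀ s : ℝ, Θ (x + s • E4.basisVector 0) = Θ x + (c * s) • E4.basisVector 0) → (∀ x ∈ (Kerr.exterior M a : Set E4), ∀ v w : E4, A.bilin (Θ x) (fderiv ℝ Θ x v) (fderiv ℝ Θ x w) = Kerr.bilin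 M a x v w) → Θ '' (Kerr.exterior M a : Set E4) = {u : E4 | ∃ h : u ∈ A.domain, A.toFun ⟨u, h⟩ ∈ 𝓑.doc} → (∀ R₁ : ℝ, ∃ R : ℝ, ∀ x ∈ (Kerr.exterior M a : Set E4), R ≤ Kerr.radius a x → R₁ ≤ A.radius (Θ x)) → (∃ R L₀ : ℝ, ∀ u ∈ (Kerr.exterior M a : Set E4), R ≤ Kerr.radius a u → |Θ u 0 - c * u 0| ≤ L₀ ∧ |A.radius (Θ u) - Kerr.radius a u| ≤ L₀ ∧ ∀ n : ℕ, 1 ≤ n → n ≤ 3 → ‖iteratedFDeriv ℝ n Θ u‖ ≤ L₀) → ∃ L : ℝ, ∀ u ∈ (Kerr.exterior M a : Set E4), Kerr.rPlus M a + 1 ≤ Kerr.radius a u → |Θ u 0 - c * u 0| ≤ L ∧ |A.radius (Θ u) - Kerr.radius a u| ≤ L ∧ ∀ n : ℕ, 1 ≤ n → n ≤ 3 → ‖iteratedFDeriv ℝ n Θ u‖ ≤ L := by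
  intro 𝓑 A M a c Θ _ _ hMa _ hΘs _ _ hΘT _ _ _ hfarb
  obtain ⟨R, L₀, hRL⟩ := hfarb
  set S : Set E4 := (Kerr.exterior M a : Set E4) with hS_def
  have hSo : IsOpen S := (Kerr.exterior M a).isOpen
  have hM : 0 < M := hMa.pos
  have hrp : 0 < Kerr.rPlus M a := by
    have : (0 : ℝ) ≤ √(M ^ 2 - a ^ 2) := Real.sqrt_nonneg _
    rw [Kerr.rPlus]; linarith
  have hSinv : ∀ x ∈ S, ∀ s : ℝ, x + s • E4.basisVector 0 ∈ S := kerrRegion_add_smul_mem a _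
  -- the compact slice-shell `K`
  set K : Set E4 := {u : E4 | u 0 = 0 ∧ Kerr.rPlus M a + 1 ≤ Kerr.radius a u ∧ Kerr.radius a u ≤ R}
    with hK_def
  have hKS : K ⊆ S := by
    rintro u ⟨-, hu, -⟩
    rw [hS_def, SetLike.mem_coe, Kerr.mem_exterior, max_lt_iff]
    constructor <;> linarith
  have hKc : IsCompact K := by
    have hc0 : Continuous fun u : E4 ↦ u 0 := PiLp.continuous_apply 2 _ 0
    have hcr : Continuous (Kerr.radius a) := Kerr.continuous_radius a
    have hclosed : IsClosed K :=
      (isClosed_eq hc0 continuous_const).inter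
        ((isClosed_le continuous_const hcr).inter (isClosed_le hcr continuous_const))
    refine Metric.isCompact_of_isClosed_isBounded hclosed ?_
    refine (Metric.isBounded_closedBall (x := (0 : E4)) (r := |R| + |a|)).subset fun u hu ↦ ?_
    obtain ⟨hu0, -, huR⟩ := hu
    rw [Metric.mem_closedBall, dist_zero_right]
    have h1 := Kerr.spatialNorm_sq_sub_sq_le_radius_sq a u
    have h2 : E4.spatialNorm u ^ 2 ≤ (|R| + |a|) ^ 2 := by
      nlinarith [abs_nonneg R, abs_nonneg a, sq_abs R, sq_abs a, le_abs_self R, Kerr.radius_nonneg a u]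
    have h3 : E4.spatialNorm u ≤ |R| + |a| :=
      (pow_le_pow_iff_left₀ (E4.spatialNorm_nonneg u) (by positivity) two_ne_zero).1 h2
    have h4 : ‖u‖ ^ 2 = u 0 ^ 2 + E4.spatialNorm u ^ 2 := by
      rw [E4.spatialNorm_sq, EuclideanSpace.real_norm_sq_eq, Fin.sum_univ_four]
      ring
    rw [hu0] at h4
    have h5 : ‖u‖ = E4.spatialNorm u := by
      nlinarith [norm_nonneg u, E4.spatialNorm_nonneg u, sq_nonneg (‖u‖ - E4.spatialNorm u),
        sq_nonneg (‖u‖ + E4.spatialNorm u)]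
    rw [h5]
    exact h3
  -- continuity on `S` of the controlled quantities
  have hΘc : ContinuousOn Θ S := hΘs.continuousOn
  have hDc : ∀ n : ℕ, ContinuousOn (iteratedFDeriv ℝ n Θ) S := fun n ↦
    (hΘs.continuousOn_iteratedFDerivWithin (m := n) (by exact_mod_cast le_top) hSo.uniqueDiffOn).congr
      fun p hp ↦ (iteratedFDerivWithin_of_isOpen n hSo hp).symm
  have hc0 : Continuous fun u : E4 ↦ u 0 := PiLp.continuous_apply 2 _ 0
  have hf₀ : ContinuousOn (fun u : E4 ↦ Θ u 0 - c * u 0) S :=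
    (hc0.comp_continuousOn hΘc).sub (continuous_const.mul hc0).continuousOn
  have hf₁ : ContinuousOn (fun u : E4 ↦ E4.spatialNorm (Θ u) - Kerr.radius a u) S :=
    ((continuous_norm.comp E4.spatial.continuous).comp_continuousOn hΘc).sub
      (Kerr.continuous_radius a).continuousOn
  -- bounds on `K`
  obtain ⟨B₀, hB₀⟩ := hKc.exists_bound_of_continuousOn (hf₀.mono hKS)
  obtain ⟨B₁, hB₁⟩ := hKc.exists_bound_of_continuousOn (hf₁.mono hKS)
  obtain ⟨G₁, hG₁⟩ := hKc.exists_bound_of_continuousOn ((hDc 1).mono hKS)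
  obtain ⟨G₂, hG₂⟩ := hKc.exists_bound_of_continuousOn ((hDc 2).mono hKS)
  obtain ⟨G₃, hG₃⟩ := hKc.exists_bound_of_continuousOn ((hDc 3).mono hKS)
  obtain ⟨CA, hCA⟩ := A.exists_abs_radius_sub_spatialNorm_le
  refine ⟨max L₀ (max B₀ (max (CA + B₁) (max G₁ (max G₂ G₃)))), fun u hu hu1 ↦ ?_⟩
  rcases le_or_gt R (Kerr.radius a u) with huR | huR
  · -- far region: the hypothesis
    obtain ⟨h0, h1, h2⟩ := hRL u hu huR
    exact ⟨h0.trans (le_max_left _ _), h1.trans (le_max_left _ _), fun n hn hn3 ↦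
      (h2 n hn hn3).trans (le_max_left _ _)⟩
  · -- bounded shell: translate to the slice `{u⁰ = 0}`
    set u' : E4 := u + (-u 0) • E4.basisVector 0 with hu'
    have hu'S : u' ∈ S := hSinv u hu _
    have hu'0 : u' 0 = 0 := by simp [hu']
    have hru' : Kerr.radius a u' = Kerr.radius a u := Kerr.radius_add_time_smul_basisVector a u _
    have hu'K : u' ∈ K := ⟨hu'0, by rw [hru']; exact hu1, by rw [hru']; exact huR.le⟩
    have huu' : u = u' + (u 0) • E4.basisVector 0 := by
      rw [hu', add_assoc, ← add_smul, neg_add_cancel, zero_smul, add_zero]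
    have hΘu : Θ u = Θ u' + (c * u 0) • E4.basisVector 0 := by
      conv_lhs => rw [huu']
      exact hΘT u' hu'S (u 0)
    refine ⟨?_, ?_, fun n hn hn3 ↦ ?_⟩
    · -- tilt
      have e : Θ u 0 - c * u 0 = Θ u' 0 - c * u' 0 := by
        rw [hΘu, hu'0]
        simp
      have h := hB₀ u' hu'K
      rw [Real.norm_eq_abs, ← e] at h
      exact h.trans ((le_max_left _ _).trans (le_max_right _ _))
    · -- radial distortion
      have e1 : A.radius (Θ u) = A.radius (Θ u') := by rw [hΘu, adaptedChart_radius_add_smul]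
      have e2 : E4.spatialNorm (Θ u) = E4.spatialNorm (Θ u') := by rw [hΘu, spatialNorm_add_smul]
      have h := hB₁ u' hu'K
      rw [Real.norm_eq_abs] at h
      have hA := hCA (Θ u')
      have : |A.radius (Θ u) - Kerr.radius a u| ≤ CA + B₁ := by
        rw [e1, ← hru']
        calc |A.radius (Θ u') - Kerr.radius a u'|
            = |(A.radius (Θ u') - E4.spatialNorm (Θ u')) + (E4.spatialNorm (Θ u') - Kerr.radius a u')| := by
              ring_nf
          _ ≤ |A.radius (Θ u') - E4.spatialNorm (Θ u')| + |E4.spatialNorm (Θ u') - Kerr.radius a u'| :=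
              abs_add_le _ _
          _ ≤ CA + B₁ := add_le_add hA h
      exact this.trans ((le_max_left _ _).trans ((le_max_right _ _).trans (le_max_right _ _)))
    · -- derivatives
      have e : iteratedFDeriv ℝ n Θ u = iteratedFDeriv ℝ n Θ u' := by
        conv_lhs => rw [huu']
        exact iteratedFDeriv_add_smul_eq hSo hΘT hu'S (u 0) hn
      rw [e]
      have hG : ‖iteratedFDeriv ℝ n Θ u'‖ ≤ max G₁ (max G₂ G₃) := by
        interval_cases n
        · exact (hG₁ u' hu'K).trans (le_max_left _ _)
        · exact (hG₂ u' hu'K).trans ((le_max_left _ _).trans (le_max_right _ _))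
        · exact (hG₃ u' hu'K).trans ((le_max_right _ _).trans (le_max_right _ _))
      exact hG.trans ((le_max_right _ _).trans ((le_max_right _ _).trans (le_max_right _ _)))

end Summit.FinalStateConjecture.FinalStateConjecture.Theorems.SymplecticDualOfTheBomb

end
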